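import Mathlib
import HarnessLib
import Summits.Ventures.LatticeQCDFlow.Scoring.IMHAcceptanceFromWeights
import Summits.Ventures.LatticeQCDFlow.Exactness.QuasiStaticPathKL

/-!
# LatticeQCDFlow / Scoring — the flow trainer's acceptance monitor is a ratio of UNBIASED estimates:
# marginals of the i.i.d. batch law and the expectations of `Σ_i W_i` and `Σ_{i≠j} min(W_i, W_j)`

HONEST FRAMING: exact (Metropolis-corrected) sampling algorithms for lattice gauge theory;
figures of merit are autocorrelation/cost numbers at stated couplings and volumes; no
continuum-physics claim.

Venture `LatticeQCDFlow` (cell pub-lqcd), sub-topic `Scoring`; FANOUT row 3 (`s0-u1-a`, S0-B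
implementation A, GEN-6).  NEW WORK of the cell (finite-sum bookkeeping over the product law),
not a published result; NO definition is introduced.  Vocabulary of record: the i.i.d. batch law is
theory-2's `blockProd (fun _ : Fin n ↦ q)` on `Fin n → X` (`Scaling/ImportanceWeights`); the
acceptance identity used is row 11's `Scoring.accRate_eq_unnormalised`
(`acc(p, q) = E_{q⊗q}[min(W, W′)] / E_q[W]` for un-normalised weights `W = c·w`,
`Scoring/IMHAcceptanceFromWeights`).  Companion of row 3's `Scoring/AcceptanceMonitorBatch` (the
same monitor on one FIXED batch).  Printed counterpart NAMED ONLY: Hoeffding's U-statistics (1948)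
— the off-diagonal pair average is the order-2 U-statistic of the kernel `min(W, W′)`.

## Content (finite population `X`, probability vector `q`, `n` i.i.d. draws `φ : Fin n → X`)

* `sum_blockProd_mul_apply_mul_apply`, `sum_blockProd_mul_apply₂` — two-coordinate marginals of a
  general block-product law `blockProd qb` (normalised blocks), for `k ≠ l`:
  `E[g(φ_k) h(φ_l)] = E_{qb_k} g · E_{qb_l} h` and `E[f(φ_k, φ_l)] = Σ_xΣ_y qb_k(x) qb_l(y) f(x,y)`
  (Fubini over the coordinates via `Fintype.prod_sum`, then an indicator expansion of `f`) — the
  companions of row 8's one-coordinate `Exactness.sum_blockProd_mul_apply`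
  (`Exactness/QuasiStaticPathKL`), which is REUSED for the denominator;
* **`sum_blockProd_mul_sum_apply`** — `E[Σ_i W(φ_i)] = n · E_q W` (the monitor's denominator);
* **`sum_blockProd_mul_sum_erase_min`** — `E[Σ_i Σ_{j≠i} min(W(φ_i), W(φ_j))] = n(n−1) · E_{q⊗q} min(W, W′)`
  (the monitor's numerator: the diagonal-free pair sum is unbiased, which is WHY the trainer removes
  the diagonal — the plug-in `Σ_iΣ_j` would add `n·E_q W`);
* **`accRate_eq_ratio_of_expectations`** — for a normalised target `p`, a positive normalised model
  `q`, `W = c·w` with any unknown `c > 0`, and `n ≥ 2`: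
  `acc(p, q) = (E[numerator]/(n(n−1))) / (E[denominator]/n)`.

Reading (value-free; nothing re-scored, no number of record moves): the engine's `acc_est`
(`latflow.flows_jax` 0.2.1 `training.py` ll. 65–73) is the ratio of two unbiased statistics whose
expectation ratio is EXACTLY the equilibrium acceptance — the precise content of its docstring's
"consistent as n → ∞; at small n … biased like any self-normalised importance estimate".
NOT CLAIMED: unbiasedness of the RATIO, any variance / concentration / consistency statement (no
limit is taken here), anything about the chain's realised acceptance; any number of ours.

Elementary (`[folklore]`-level); farm `lean check` rc 0, no `sorry`.
-/

namespace Summit.Ventures.LatticeQCDFlow.Scoring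

open Finset
open Summit.Ventures.LatticeQCDFlow.Exactness
open Summit.Ventures.LatticeQCDFlow.Theory2

section IID

variable {X : Type*} [Fintype X] {n : ℕ}

/-- **Two-coordinate product marginal of a block-product law**: for `k ≠ l` and normalised blocks,
`Σ_φ (Π_i qb_i(φ_i)) · g(φ_k) · h(φ_l) = (Σ_z qb_k(z) g(z)) · (Σ_z qb_l(z) h(z))` — the companion of
row 8's one-coordinate `Exactness.sum_blockProd_mul_apply`. [folklore] -/
theorem sum_blockProd_mul_apply_mul_apply {m : ℕ} {Z : Type*} [Fintype Z] (qb : Fin m → Z → ℝ)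
    (hq1 : ∀ i, ∑ z, qb i z = 1) (g h : Z → ℝ) {k l : Fin m} (hkl : k ≠ l) :
    ∑ φ : Fin m → Z, blockProd qb φ * (g (φ k) * h (φ l))
      = (∑ z, qb k z * g z) * ∑ z, qb l z * h z := by
  have hφ : ∀ φ : Fin m → Z, blockProd qb φ * (g (φ k) * h (φ l))
      = ∏ i, (qb i (φ i) * (if i = k then g (φ i) else 1) * (if i = l then h (φ i) else 1)) := by
    intro φ
    rw [prod_mul_distrib, prod_mul_distrib, Fintype.prod_ite_eq', Fintype.prod_ite_eq']
    simp only [blockProd]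
    ring
  simp_rw [hφ]
  have e := Fintype.prod_sum
    (fun (i : Fin m) (z : Z) => qb i z * (if i = k then g z else 1) * (if i = l then h z else 1))
  rw [← e]
  have h2 : ∀ i : Fin m, ∑ z, qb i z * (if i = k then g z else 1) * (if i = l then h z else 1)
      = (if i = k then ∑ z, qb k z * g z else 1) * (if i = l then ∑ z, qb l z * h z else 1) := by
    intro i
    by_cases hk : i = k
    · subst hk
      simp only [if_true, if_neg hkl, mul_one]
    · by_cases hl : i = l
      · subst hl
        simp only [if_true, if_neg hk, mul_one, one_mul]
      · simp only [if_neg hk, if_neg hl, mul_one, hq1 i]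
  simp_rw [h2]
  rw [prod_mul_distrib, Fintype.prod_ite_eq', Fintype.prod_ite_eq']

/-- **Two-coordinate marginal, general integrand**: for `k ≠ l` and any `f : Z → Z → ℝ`,
`Σ_φ (Π_i qb_i(φ_i)) · f(φ_k, φ_l) = Σ_x Σ_y qb_k(x) qb_l(y) f(x, y)`. [folklore] -/
theorem sum_blockProd_mul_apply₂ {m : ℕ} {Z : Type*} [Fintype Z] (qb : Fin m → Z → ℝ)
    (hq1 : ∀ i, ∑ z, qb i z = 1) (f : Z → Z → ℝ) {k l : Fin m} (hkl : k ≠ l) :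
    ∑ φ : Fin m → Z, blockProd qb φ * f (φ k) (φ l) = ∑ x, ∑ y, qb k x * qb l y * f x y := by
  classical
  -- expand `f (φ k) (φ l)` over indicators
  have hf : ∀ φ : Fin m → Z, f (φ k) (φ l)
      = ∑ x, ∑ y, f x y * ((if φ k = x then (1 : ℝ) else 0) * (if φ l = y then 1 else 0)) := by
    intro φ
    have h1 : ∀ x, ∑ y, f x y * ((if φ k = x then (1 : ℝ) else 0) * (if φ l = y then 1 else 0))
        = (if φ k = x then 1 else 0) * f x (φ l) := by
      intro x
      have : ∀ y, f x y * ((if φ k = x then (1 : ℝ) else 0) * (if φ l = y then 1 else 0))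
          = if φ l = y then (if φ k = x then 1 else 0) * f x y else 0 := by
        intro y; split_ifs <;> ring
      simp_rw [this]
      exact Fintype.sum_ite_eq (φ l) (fun y => (if φ k = x then (1 : ℝ) else 0) * f x y)
    simp_rw [h1]
    have : ∀ x, (if φ k = x then (1 : ℝ) else 0) * f x (φ l) = if φ k = x then f x (φ l) else 0 := by
      intro x; split_ifs <;> ring
    simp_rw [this]
    exact (Fintype.sum_ite_eq (φ k) (fun x => f x (φ l))).symm
  simp_rw [hf, mul_sum]
  rw [Finset.sum_comm]
  refine sum_congr rfl fun x _ => ?_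
  rw [Finset.sum_comm]
  refine sum_congr rfl fun y _ => ?_
  have e : ∀ φ : Fin m → Z, blockProd qb φ
        * (f x y * ((if φ k = x then (1 : ℝ) else 0) * (if φ l = y then 1 else 0)))
      = f x y * (blockProd qb φ
        * ((if φ k = x then (1 : ℝ) else 0) * (if φ l = y then 1 else 0))) := fun φ => by ring
  simp_rw [e]
  rw [← mul_sum, sum_blockProd_mul_apply_mul_apply qb hq1 (fun z => if z = x then (1 : ℝ) else 0)
    (fun z => if z = y then (1 : ℝ) else 0) hkl]
  have i1 : ∑ z, qb k z * (if z = x then (1 : ℝ) else 0) = qb k x := by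
    simp_rw [mul_ite, mul_one, mul_zero]; exact Fintype.sum_ite_eq' x _
  have i2 : ∑ z, qb l z * (if z = y then (1 : ℝ) else 0) = qb l y := by
    simp_rw [mul_ite, mul_one, mul_zero]; exact Fintype.sum_ite_eq' y _
  rw [i1, i2]
  ring

/-! ### The two monitors' numerators and denominators are unbiased -/

/-- **The batch weight sum is unbiased for `n·E_q W`.** -/
theorem sum_blockProd_mul_sum_apply (q W : X → ℝ) (hq1 : ∑ x, q x = 1) :
    ∑ φ : Fin n → X, blockProd (fun _ => q) φ * ∑ i, W (φ i) = n * ∑ x, q x * W x := by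
  have h : ∀ φ : Fin n → X, blockProd (fun _ => q) φ * ∑ i, W (φ i)
      = ∑ i, blockProd (fun _ => q) φ * W (φ i) := fun φ => mul_sum _ _ _
  simp_rw [h]
  rw [Finset.sum_comm]
  simp_rw [sum_blockProd_mul_apply (fun _ : Fin n => q) (fun _ => hq1) _ W]
  rw [sum_const, card_univ, Fintype.card_fin, nsmul_eq_mul]

/-- **The off-diagonal min-sum (the monitor's numerator) is unbiased for `n(n−1)·E_{q⊗q} min(W, W′)`.** -/
theorem sum_blockProd_mul_sum_erase_min (q W : X → ℝ) (hq1 : ∑ x, q x = 1) :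
    ∑ φ : Fin n → X, blockProd (fun _ => q) φ * ∑ i, ∑ j ∈ univ.erase i, min (W (φ i)) (W (φ j))
      = n * (n - 1) * ∑ x, ∑ y, q x * q y * min (W x) (W y) := by
  have hm : ∀ φ : Fin n → X,
      blockProd (fun _ => q) φ * ∑ i, ∑ j ∈ univ.erase i, min (W (φ i)) (W (φ j))
      = ∑ i, ∑ j ∈ univ.erase i, blockProd (fun _ => q) φ * min (W (φ i)) (W (φ j)) := by
    intro φ
    rw [mul_sum]
    exact sum_congr rfl fun i _ => mul_sum _ _ _
  simp_rw [hm]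
  rw [Finset.sum_comm]
  have h : ∀ i : Fin n, ∑ φ : Fin n → X, ∑ j ∈ univ.erase i,
      blockProd (fun _ => q) φ * min (W (φ i)) (W (φ j))
      = (n - 1) * ∑ x, ∑ y, q x * q y * min (W x) (W y) := by
    intro i
    rw [Finset.sum_comm]
    have h2 : ∀ j ∈ univ.erase i, ∑ φ : Fin n → X, blockProd (fun _ => q) φ * min (W (φ i)) (W (φ j))
        = ∑ x, ∑ y, q x * q y * min (W x) (W y) := fun j hj =>
      sum_blockProd_mul_apply₂ (fun _ : Fin n => q) (fun _ => hq1) (fun x y => min (W x) (W y))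
        (ne_of_mem_erase hj).symm
    rw [sum_congr rfl h2, sum_const, card_erase_of_mem (mem_univ i), card_univ, Fintype.card_fin,
      nsmul_eq_mul]
    have hn : 1 ≤ n := i.pos
    rw [Nat.cast_sub hn, Nat.cast_one]
  simp_rw [h]
  rw [sum_const, card_univ, Fintype.card_fin, nsmul_eq_mul]
  ring

/-- **The equilibrium acceptance is the ratio of the two unbiased targets.**  For a normalised
target `p`, a positive model `q` and un-normalised weights `W = c·w` (`c > 0`), with `n ≥ 2` i.i.d.
proposals: `acc(p, q) = (E[Σ_{i≠j} min(W_i, W_j)]/(n(n−1))) / (E[Σ_i W_i]/n)` — the trainer's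
monitor is the ratio of unbiased estimates of the numerator and the denominator of the acceptance
(row 11's `accRate_eq_unnormalised`), which is what makes it consistent; the ratio itself is not
claimed unbiased. -/
theorem accRate_eq_ratio_of_expectations {p q : X → ℝ} (hp1 : ∑ x, p x = 1) (hq : ∀ x, 0 < q x)
    (hq1 : ∑ x, q x = 1) {c : ℝ} (hc : 0 < c) (hn : 2 ≤ n) :
    accRate p q
      = ((∑ φ : Fin n → X, blockProd (fun _ => q) φ
            * ∑ i, ∑ j ∈ univ.erase i, min (c * weight p q (φ i)) (c * weight p q (φ j)))
          / (n * (n - 1)))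
        / ((∑ φ : Fin n → X, blockProd (fun _ => q) φ * ∑ i, c * weight p q (φ i)) / n) := by
  rw [sum_blockProd_mul_sum_erase_min q (fun x => c * weight p q x) hq1,
    sum_blockProd_mul_sum_apply q (fun x => c * weight p q x) hq1,
    accRate_eq_unnormalised hp1 hq hc]
  have hn0 : (n : ℝ) ≠ 0 := by
    have : (2 : ℝ) ≤ n := by exact_mod_cast hn
    exact (by linarith : (0 : ℝ) < n).ne'
  have hn1 : (n : ℝ) - 1 ≠ 0 := by
    have : (2 : ℝ) ≤ n := by exact_mod_cast hn
    exact (by linarith : (0 : ℝ) < n - 1).ne'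
  rw [mul_div_cancel_left₀ _ (mul_ne_zero hn0 hn1), mul_div_cancel_left₀ _ hn0]

end IID

end Summit.Ventures.LatticeQCDFlow.Scoring
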